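import Literature.MathematicalPhysics.QuantumFieldTheory.Balaban1983to89.B10Eq27TorusAxialLog
import Literature.MathematicalPhysics.QuantumFieldTheory.Balaban1983to89.BlockAveragingEMLProp2
import Literature.MathematicalPhysics.QuantumFieldTheory.Balaban1983to89.T3PrintedRegularMinimiser
import Summits.QuantumFields.YangMills.Theorems.AlphaInputsT3ACv2
import Summits.QuantumFields.YangMills.Theorems.UnitScaleTiltFluctuationComparisonRegPrGlobalSlackKernelLegGeometry
import Summits.QuantumFields.YangMills.Theorems.UnitScaleTiltFluctuationComparisonRegPrGlobalSlackKernelLegCfgFixedPoint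
import HarnessLib

/-!
# `UnitScaleTiltFluctuationComparisonRegPrGlobalSlackLegCfgDistT3` — PRINT'S (44) FOR THE NATURAL OLD-LEVEL CONFIGURATION FAMILY: the (27)-loop variables of the block
# averages of the r1 minimiser, leg by leg, in the currency of the (R4-low) row `CfgDistOwnΦLow` (crux `FluctuationComparisonRegPrIntL`, stmt-QuantumFields-20520, skeleton v5kC,
# STUB 3⁗χ `stub_globalTwoRunSlackFamChi`; cell `pub/ym-inputs`, seat ym-inputs-p11 = INPUT-LIST I-11 rows `KernelLegPointwiseΦ` + `CfgDistΦ`; count-neutral helper, registry untouched)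

WHY.  By name the I-11 row `CfgDistΦ` (`…GlobalSlackKernelLegWeights`: print's (44) p.267 in distance form, both runs) is the transfer `cfgDistΦ_of_own` (`…KernelLegPerRun`) of the
single-run row (R4) `CfgDistOwnΦ` — «on run `K`'s `θ(n)`-window and listed domains, leg by leg, `‖B K (K−n) j Y (V↑) c‖ ≤ C_s·(1 + d(c))·θ(n)·x²`, `x = L^{−(K−n−1−j)}`» —, whose
new-level clause is `bound28` (`…KernelLegDisplayProfileLow.cfgDistOwnΦ_chi_of_low_of_newLevelIsBirth`) and whose OLD-LEVEL part (R4-low) `CfgDistOwnΦLow` (`j + 1 < K − n`: the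
listed domains are then the single blocks `blockSet K (1+j) y′` of `canonLocCore`) is a row of the door display `K1aLegRowsDisplayChiAt(Low)` that no file supplies: the configuration
family `B` at the old levels is ∃-quantified (pinned only by (M1) `OldTermsAreJetsOwn`), and its definition at Bałaban's data is the (α)-record desk's (NODE-O B0).  In print the
old-level loop variables ARE NAMED: (43)–(44) p.266–267 evaluate `𝒫_j(Y_j, U_k)` at `B_k(c) = (1/i) log Ū_k^j(Γ_{y,c₋} ∪ c ∪ Γ_{c₊,y})` — the (27)-loop variables of the `j`-fold AVERAGE
of the minimiser `U_k`, anchored at the block `y` — and (44) is two printed sentences: «The configuration U_k satisfies … |U_k(∂p) − 1| < 2L²B₃g_{k−1}p(g_{k−1})η².  This implies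
the condition |U_k^j(∂p′) − 1| < 4L²B₃g_{k−1}p(g_{k−1})(Lʲη)² for p′ ⊂ Ω_k^{(j)}, and from (43) we get … (Lʲη)⁻¹|c_{i,−} − y|·8L²B₃g_{k−1}p(g_{k−1})(Lʲη)²» (p.267 L1–5).  Both
halves are PROVED in the tree and had never been composed at the row's letters: [Balaban1985Averaging] Prop. 2 for the averaging of record (`BlockAveragingEMLProp2.
plaqSmall_iter_blockAvg_eml_level`) and (27)–(28) on the torus (`B10Eq27TorusAxialLog.norm_B27T_le` / `eq28T_specialUnitaryGroup`).  This file composes them, def-free: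

* §1 (generic torus `P`, `SU(N)`): **`norm_B27T_le_of_plaqSmall`** — (28) under a GLOBAL plaquette bound (`PlaqSmall α U`, box = the whole symmetric window): `‖B(c)‖ ≤ 2|c₋−y|₁·α`
  whenever `|c₋−y|₁·α ≤ ½`; **`norm_B27T_iter_blockAvg_le`** — (44)'s left display: `PlaqSmall (α₀η²) U`, `η = L^{−k}`, [B7] Prop. 2's letters ⟹ for `i ≤ k` the loop variables of
  `Ū^i = Averaging.iter (blockAvg ℰp) i U` obey `‖B(c)‖ ≤ 2|c₋−y|₁·2α₀(Lⁱη)²`.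
* §2 (T³ letters): **`norm_B27T_iter_blockAvg_le_T3(_row)`** — from the plaquette clause of print's (2) `PlaqSmall (regThreshold F n K e) U` (= r1's `regFibrePr … (B₃ε₁)`), for
  `j ≤ K − n`: `‖B(c)‖ ≤ 4e·|c₋−y|₁·(L^{K−n−j})⁻² ≤ 4e·|c₋−y|₁·(L^{K−n−1−j})⁻²` — the row's level factor.
* §3 (the (α) record): **`plaqSmall_minimiser_of_rows`** (r1 on the `θ(n)`-window ⟹ print's plaquette clause for `U_{K−n}(triv, V↑)` at `e = B₃θ(n)`) and
  **`norm_B27T_avg_minimiser_le`** — (44) for the loop variables of `Ū^j_{K−n}(triv, V↑)`: `‖B(c)‖ ≤ 4B₃·θ(n)·|c₋−y|₁·(L^{K−n−1−j})⁻²`.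
* §4 block geometry: `cast_l1_rel_eq_pdist` (the (27) letters `|c₋−y|₁ = l1 ∘ rel` ARE the leg-distance letters `pdist`), `pdist_le_of_mem_shadow_blockSet` (two anchors of one block
  are `3(L−1)`-close), **`l1_rel_le_canonLegDist_add`** / `l1_rel_le_mul_one_add_canonLegDist`: for `Y = blockSet K i y′` and ANY `y ∈ anchors K b Y`,
  `|c₋−y|₁ ≤ canonLegDist F K b Y c + 3(L−1) ≤ 3L·(1 + canonLegDist F K b Y c)`.
* §5 **`norm_B27T_avg_minimiser_le_canonLegDist`** — THE ROW'S CURRENCY: for an old level `j + 1 < K − n`, `Y = blockSet K (j+1) y′`, `y ∈ anchors K j Y`: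
  `‖B(c)‖ ≤ (12·L·B₃)·(1 + canonLegDist F K j Y c)·θ(n)·(L^{K−n−1−j})⁻²` = the right-hand side of `CfgDistOwnΦLow … (canonLegDist F) 𝔠.b₀ 𝔠.p₀ (12LB₃)` verbatim.

WHAT THIS IS / IS NOT (located, by name).  (i) Both p11 rows are conjuncts INSIDE the existential `∃ p Φ e B` of `K1aLegRowsRChi`; in isolation each is satisfied by `Φ := 0` /
`B := 0`, so a «row file» is meaningful only for a DEFINED family.  This file proves the analytic inequality of (R4-low) for the NATURAL family (print's own `B_k`); the definer's
discharge of (R4-low) is then `B K (K−n) j (blockSet K (1+j) y′) W c := B27T (…Ū^j(U_{K−n}(triv, W))…) y c` (anchor `y ∈ anchors`, a choice) + §5 — it does NOT define `B` (def-free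
token), does NOT close `CfgDistΦ` / 3⁗χ / the crux, touches no skeleton or package file.  (ii) FAR LEGS: print uses (44) only inside `□̃` (`|c₋−y|₁·α` small — the localisation of
`𝒫_j(Y_j)`, p.263 L4); the row as typed asks a bound at EVERY bond `c`, where `B27T` (a power-series logarithm) is not print's object — the hypothesis `hsmall` below is print's
regime, and the far legs are the definer's convention (cut-off or localised chart), flagged here, not resolved.  (iii) `KernelLegPointwiseΦ` ((43), per-leg kernel decay) is NOT
touched: for the canonical birth charts it needs the propagator-chain structure of the step charts (p.264 L20–24), an (α)-record display ((R2′) `ChartAnalyticΦ (rescaleΦw …)`), not a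
lemma over the recorded sup-norm analyticity.  Nothing of [Balaban1985UV3] / [Balaban1985Variational] / [Balaban1985Averaging] is asserted beyond the cited, already-proved tree
theorems; no summit / rung / gap claim (YM₃ on T³ is ladder rung R3, not the Clay problem).

References: T. Bałaban, CMP 102 (1985) 255–275 [Balaban1985UV3] ((27)–(28) p.263, p.263 L4, (43)–(45) pp.266–267, p.267 L1–5); CMP 102 (1985) 277–309 [Balaban1985Variational]
((2) p.278, (6) p.278, Thm 1 (8) p.279); CMP 98 (1985) 17–51 [Balaban1985Averaging] (Prop. 2 (52)–(54) p.26, pp.24–25); CMP 109 (1987) 249–301 [Balaban1987RG1] ((0.1)–(0.3) pp.251–252).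
-/

set_option autoImplicit false

noncomputable section

open scoped Matrix.Norms.L2Operator
open Literature.MathematicalPhysics.QuantumFieldTheory.Balaban1983to89
open Literature.MathematicalPhysics.QuantumFieldTheory.Balaban1983to89.T3ContinuumYM3Torus
open Literature.MathematicalPhysics.QuantumFieldTheory.Balaban1983to89.T3UnitLawDensityEML (ℰp)
open Literature.MathematicalPhysics.QuantumFieldTheory.Balaban1983to89.T3UnitScaleTilt (θBal)
open Literature.MathematicalPhysics.QuantumFieldTheory.Balaban1983to89.T3LevelShift (fieldShift)
open Literature.MathematicalPhysics.QuantumFieldTheory.Balaban1983to89.T3RegularMinimiser (regThreshold)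
open Literature.MathematicalPhysics.QuantumFieldTheory.Balaban1983to89.T3PrintedRegularMinimiser (mem_regFibrePr_iff)
open Literature.MathematicalPhysics.QuantumFieldTheory.Balaban1983to89.B10Eq27TorusAxialLog
open Literature.MathematicalPhysics.QuantumFieldTheory.Balaban1983to89.B7Prop1Explicit (l1 e)
open Literature.MathematicalPhysics.QuantumFieldTheory.Balaban1983to89.B7Prop1Local (InBox)
open Literature.MathematicalPhysics.QuantumFieldTheory.Balaban1983to89.B7Prop2Explicit (unitaryUnits)
open Literature.MathematicalPhysics.QuantumFieldTheory.Balaban1983to89.BlockAveragingEMLProp2 (plaqSmall_iter_blockAvg_eml_level)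
open Literature.MathematicalPhysics.QuantumFieldTheory.Balaban1983to89.ExpMeanLog (expMeanLogSU deltaSU)
open Literature.MathematicalPhysics.QuantumFieldTheory.Balaban1983to89.BlockAveraging (blockAvg)
open Literature.MathematicalPhysics.QuantumFieldTheory.Balaban1983to89.B12Decay510Torus (pabs pabs_eq_natAbs pabs_le_abs_of_cast_eq)
open Literature.MathematicalPhysics.QuantumFieldTheory.Balaban1985CMP102
open Literature.MathematicalPhysics.QuantumFieldTheory.Balaban1985CMP102.Setting
open Summit.QuantumFields.Balaban3D.Carriers
open Summit.QuantumFields.Balaban3D.Proofs.Primitives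
open Summit.QuantumFields.Balaban3D.Proofs.TorusLift (val_coarsen)
open Summit.QuantumFields.YangMills.Theorems
open Summit.QuantumFields.YangMills.Theorems.GlobalSlackCanonicalPolymers

namespace Summit.QuantumFields.YangMills.Theorems.GlobalSlackKernelLeg

/-! ## §1 (28) on the whole torus under a global plaquette bound, and (44)'s left display for the averaged field -/

section Torus

variable {P : Params} {j : ℕ} {N : ℕ} [NeZero N]

/-- The relative position `x − y` (least-absolute-value representatives) lies in the integer box `[−n, n]^d`, `n` the period. [folklore] -/
theorem inBox_window_rel (y x : Site P j) :
    InBox (fun _ => -(P.sitesPerDir j : ℤ)) (fun _ => (P.sitesPerDir j : ℤ)) (rel y x) := by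
  intro i
  have h := natAbs_rel_le y x i
  have h2 : ((rel y x i).natAbs : ℤ) ≤ (P.sitesPerDir j : ℤ) := by
    have : P.sitesPerDir j / 2 ≤ P.sitesPerDir j := Nat.div_le_self _ _
    exact_mod_cast h.trans this
  refine ⟨?_, ?_⟩ <;> dsimp only <;> omega

/-- So does `x − y + e_μ` (one more layer: `|(x − y)_ν| ≤ n/2 < n`). [folklore] -/
theorem inBox_window_rel_add_e (y x : Site P j) (μ : Fin P.d) :
    InBox (fun _ => -(P.sitesPerDir j : ℤ)) (fun _ => (P.sitesPerDir j : ℤ)) (rel y x + e μ) := by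
  intro i
  have h := natAbs_rel_le y x i
  have hT : 2 ≤ P.sitesPerDir j := by  -- `2·L^{m+K−j}` (the BIJ85 cell's `two_le_sitesPerDir`, not imported here)
    unfold Params.sitesPerDir
    have := Nat.one_le_pow (P.m + P.K - j) P.L P.L_pos
    omega
  have h2 : 2 * ((rel y x i).natAbs : ℤ) ≤ (P.sitesPerDir j : ℤ) := by
    have : 2 * (P.sitesPerDir j / 2) ≤ P.sitesPerDir j := Nat.mul_div_le _ _
    exact_mod_cast (Nat.mul_le_mul_left 2 h).trans this
  have he : (e μ : Fin P.d → ℤ) i = 0 ∨ (e μ : Fin P.d → ℤ) i = 1 := by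
    by_cases hi : i = μ
    · subst hi; exact Or.inr (Pi.single_eq_same _ _)
    · exact Or.inl (Pi.single_eq_of_ne hi _)
  have hT' : (2 : ℤ) ≤ (P.sitesPerDir j : ℤ) := by exact_mod_cast hT
  refine ⟨?_, ?_⟩ <;> dsimp only <;> rw [Pi.add_apply] <;> rcases he with he | he <;> rw [he] <;> omega

/-- The origin lies in the box `[−n, n]^d`. [folklore] -/
theorem inBox_window_zero (P : Params) (j : ℕ) :
    InBox (fun _ => -(P.sitesPerDir j : ℤ)) (fun _ => (P.sitesPerDir j : ℤ)) (0 : Fin P.d → ℤ) :=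
  fun i => by refine ⟨?_, ?_⟩ <;> dsimp only <;> rw [Pi.zero_apply] <;> omega

/-- **(28) ON THE WHOLE TORUS UNDER A GLOBAL PLAQUETTE BOUND** (`SU(N)`-valued configurations): if every plaquette variable of `U` is within `α` of `1`
(`PlaqSmall α U`), then for every anchor `y` and every bond `c` with `|c₋ − y|₁·α ≤ ½` the loop variable (27) satisfies `‖B(c)‖ ≤ 2|c₋ − y|₁·α`
(`norm_B27T_le` with the box = the whole symmetric window). [cite: Balaban1985UV3, (27)-(28) p.263] -/
theorem norm_B27T_le_of_plaqSmall (U : GaugeField P j (Matrix.specialUnitaryGroup (Fin N) ℂ)) {α : ℝ} (hα : 0 ≤ α)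
    (hU : PlaqSmall α U) (y : Site P j) (c : PBond P j) (hsmall : (l1 (rel y c.src) : ℝ) * α ≤ 1 / 2) :
    ‖B27T (unitsField (toUField U)) y c‖ ≤ 2 * ((l1 (rel y c.src) : ℝ) * α) := by
  letI : CStarAlgebra (Matrix (Fin N) (Fin N) ℂ) := B10Eq29TubeLine.cstarAlgebraMatrix N
  have hU1 : ∀ b, unitsField (toUField U) b ∈ unitaryUnits (Matrix (Fin N) (Fin N) ℂ) := unitsField_mem_unitaryUnits _
  have h13 := h13_unitsField (lo := fun _ => -(P.sitesPerDir j : ℤ)) (hi := fun _ => (P.sitesPerDir j : ℤ)) (toUField U) y (α := α)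
    (fun z κ μ hκμ _ => by rw [dist1_plaqHol_toUField]; exact (hU _).le)
  exact norm_B27T_le (fun i => by omega) (unitsField (toUField U)) (U1_of_unitaryUnits hU1) y h13 hα
    (inBox_window_zero P j) c (inBox_window_rel y c.src) (inBox_window_rel_add_e y c.src c.dir) hsmall

/-- **PRINT'S (44), LEFT DISPLAY, FOR THE LOOP VARIABLES OF THE AVERAGED FIELD** — the two printed sentences p.267 L1–3 composed: if the fine field `U` on
`T^{(0)}` has `|U(∂p) − 1| < α₀η²` for every plaquette (`η = L^{−k}`; [B7] Prop. 2's (52), smallness letters `C₀(d)α₀ ≤ ⅓`, `2α₀ ≤ c′₂`), then for every level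
`i ≤ k` the (27)-loop variables of the `i`-fold `ℰp`-average `Ū^i` anchored at `y ∈ T^{(i)}` satisfy `‖B(c)‖ ≤ 2·|c₋ − y|₁·2α₀(Lⁱη)²` on every bond `c` of
`T^{(i)}` with `|c₋ − y|₁·2α₀(Lⁱη)² ≤ ½` («|U_k(∂p) − 1| < 2L²B₃g p η². This implies |U_k^j(∂p′) − 1| < 4L²B₃g p (Lʲη)² … and from (43) we get … (Lʲη)⁻¹|c₋ − y|·8L²B₃g p (Lʲη)²»;
distances here in level-`i` lattice units). [cite: Balaban1985UV3, (44) p.267; Balaban1985Averaging, Prop. 2 (52)-(54) p.26] -/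
theorem norm_B27T_iter_blockAvg_le (k : ℕ) {α₀ : ℝ} (hα : 0 < α₀)
    (hα3 : (143 * ((((P.d + 4 : ℕ) : ℝ)) ^ 2 / 4) ^ 2) * α₀ ≤ 1 / 3)
    (hα2 : 2 * α₀ ≤ 2 * deltaSU (Fin N) / (((P.d + 4) * P.L : ℕ) : ℝ) ^ 2)
    {U : GaugeField P 0 (Matrix.specialUnitaryGroup (Fin N) ℂ)} (h52 : PlaqSmall (α₀ * (((P.L : ℝ) ^ k)⁻¹) ^ 2) U)
    {i : ℕ} (hi : i ≤ k) (y : Site P i) (c : PBond P i)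
    (hsmall : (l1 (rel y c.src) : ℝ) * (2 * α₀ * ((P.L : ℝ) ^ i * ((P.L : ℝ) ^ k)⁻¹) ^ 2) ≤ 1 / 2) :
    ‖B27T (unitsField (toUField (Averaging.iter (fun _ => blockAvg (expMeanLogSU (n := Fin N))) i U))) y c‖ ≤
      2 * ((l1 (rel y c.src) : ℝ) * (2 * α₀ * ((P.L : ℝ) ^ i * ((P.L : ℝ) ^ k)⁻¹) ^ 2)) :=
  norm_B27T_le_of_plaqSmall _ (by positivity) (plaqSmall_iter_blockAvg_eml_level k hα hα3 hα2 h52 hi) y c hsmall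

end Torus

/-! ## §2 The same at the T³ letters of the (44) row: print's regular space (2)/(6) of run `K` over the height `n`, level factor `(L^{K−n−j})⁻²` -/

section T3

variable (F : T3Family)

/-- Level arithmetic: `Lʲ·(L^{K−n})⁻¹ = (L^{K−n−j})⁻¹` for `j ≤ K − n`. [folklore] -/
theorem pow_mul_inv_pow_eq {n K j : ℕ} (hj : j ≤ K - n) :
    (F.L : ℝ) ^ j * ((F.L : ℝ) ^ (K - n))⁻¹ = ((F.L : ℝ) ^ (K - n - j))⁻¹ := by
  have hL0 : (F.L : ℝ) ≠ 0 := by have := F.hL.2; positivity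
  have h : (F.L : ℝ) ^ (K - n) = (F.L : ℝ) ^ j * (F.L : ℝ) ^ (K - n - j) := by rw [← pow_add]; congr 1; omega
  rw [h, mul_inv, ← mul_assoc, mul_inv_cancel₀ (pow_ne_zero _ hL0), one_mul]

/-- The level factor of the (44) row dominates the exact one: `(L^{K−n−j})⁻² ≤ (L^{K−n−1−j})⁻²` (`L ≥ 2`). [folklore] -/
theorem inv_pow_sq_le_row {n K j : ℕ} :
    (((F.L : ℝ) ^ (K - n - j))⁻¹) ^ 2 ≤ (((F.L : ℝ) ^ (K - n - 1 - j))⁻¹) ^ 2 := by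
  have hL1 : (1 : ℝ) ≤ F.L := by exact_mod_cast F.hL.2.le
  have h0 : (0 : ℝ) < (F.L : ℝ) ^ (K - n - 1 - j) := by positivity
  exact pow_le_pow_left₀ (by positivity) (inv_anti₀ h0 (pow_le_pow_right₀ hL1 (by omega))) 2

/-- **(44) AT THE T³ LETTERS, FROM PRINT'S PLAQUETTE CLAUSE OF (2)**: if `U` on the finest lattice of run `K` satisfies `|U(∂p) − 1| < e·L^{−2(K−n)}` for every plaquette
(`PlaqSmall (regThreshold F n K e) U` — the plaquette half of `RegPr`, [Balaban1985Variational] (2) p.278), with `e` inside [B7] Prop. 2's smallness letters at `d = 3`,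
then for every level `j ≤ K − n`, anchor `y ∈ T^{(j)}` and bond `c` of `T^{(j)}` with `|c₋ − y|₁·2e(L^{K−n−j})⁻² ≤ ½`, the (27)-loop variable of the `j`-fold
`ℰp`-average satisfies `‖B(c)‖ ≤ 4e·|c₋ − y|₁·(L^{K−n−j})⁻²`. [cite: Balaban1985UV3, (44) p.267; Balaban1985Variational, (2) p.278] -/
theorem norm_B27T_iter_blockAvg_le_T3 {n K : ℕ} {e : ℝ} (he : 0 < e)
    (he3 : (143 * ((((3 + 4 : ℕ) : ℝ)) ^ 2 / 4) ^ 2) * e ≤ 1 / 3)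
    (he2 : 2 * e ≤ 2 * deltaSU (Fin 2) / (((3 + 4) * F.L : ℕ) : ℝ) ^ 2)
    {U : GaugeField (F.P K) 0 (Matrix.specialUnitaryGroup (Fin 2) ℂ)} (hU : PlaqSmall (regThreshold F n K e) U)
    {j : ℕ} (hj : j ≤ K - n) (y : Site (F.P K) j) (c : PBond (F.P K) j)
    (hsmall : (l1 (rel y c.src) : ℝ) * (2 * e * (((F.L : ℝ) ^ (K - n - j))⁻¹) ^ 2) ≤ 1 / 2) :
    ‖B27T (unitsField (toUField (Averaging.iter (fun i => BlockAveraging.blockAvg (P := F.P K) (j := i) ℰp) j U))) y c‖ ≤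
      4 * e * (l1 (rel y c.src) : ℝ) * (((F.L : ℝ) ^ (K - n - j))⁻¹) ^ 2 := by
  have key := pow_mul_inv_pow_eq F (n := n) (K := K) hj
  have h52 : PlaqSmall (e * ((((F.P K).L : ℝ) ^ (K - n))⁻¹) ^ 2) U := by
    intro p
    convert hU p using 2
    rw [regThreshold, ← inv_pow, ← pow_mul, mul_comm 2]
    rfl
  have h := norm_B27T_iter_blockAvg_le (P := F.P K) (N := 2) (K - n) he he3 he2 h52 hj y c
    (by rw [show ((F.P K).L : ℝ) = F.L from rfl, key]; exact hsmall)
  rw [show ((F.P K).L : ℝ) = F.L from rfl, key] at h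
  calc _ ≤ 2 * ((l1 (rel y c.src) : ℝ) * (2 * e * (((F.L : ℝ) ^ (K - n - j))⁻¹) ^ 2)) := h
    _ = _ := by ring

/-- **THE SAME WITH THE (44) ROW'S LEVEL FACTOR** `x² = (L^{K−n−1−j})⁻²` (`CfgDistOwnΦ` / `CfgDistOwnΦLow`): `‖B(c)‖ ≤ 4e·|c₋ − y|₁·(L^{K−n−1−j})⁻²`.
[cite: Balaban1985UV3, (44) p.267] -/
theorem norm_B27T_iter_blockAvg_le_T3_row {n K : ℕ} {e : ℝ} (he : 0 < e)
    (he3 : (143 * ((((3 + 4 : ℕ) : ℝ)) ^ 2 / 4) ^ 2) * e ≤ 1 / 3)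
    (he2 : 2 * e ≤ 2 * deltaSU (Fin 2) / (((3 + 4) * F.L : ℕ) : ℝ) ^ 2)
    {U : GaugeField (F.P K) 0 (Matrix.specialUnitaryGroup (Fin 2) ℂ)} (hU : PlaqSmall (regThreshold F n K e) U)
    {j : ℕ} (hj : j ≤ K - n) (y : Site (F.P K) j) (c : PBond (F.P K) j)
    (hsmall : (l1 (rel y c.src) : ℝ) * (2 * e * (((F.L : ℝ) ^ (K - n - j))⁻¹) ^ 2) ≤ 1 / 2) :
    ‖B27T (unitsField (toUField (Averaging.iter (fun i => BlockAveraging.blockAvg (P := F.P K) (j := i) ℰp) j U))) y c‖ ≤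
      4 * e * (l1 (rel y c.src) : ℝ) * (((F.L : ℝ) ^ (K - n - 1 - j))⁻¹) ^ 2 :=
  (norm_B27T_iter_blockAvg_le_T3 F he he3 he2 hU hj y c hsmall).trans (mul_le_mul_of_nonneg_left (inv_pow_sq_le_row F) (by positivity))

end T3

/-! ## §3 At the (α) record's r1 minimiser on the `θ(n)`-window: (44) for the loop variables of `Ū_K^j(V)`, the natural old-level configuration family -/

section Record

variable {F : T3Family} {𝔠 : AlphaConsts F.L (suGroupModel 2).N} {γ : ℝ} {hγ : 0 < γ} {hγ1 : γ ≤ (min 𝔠.gamma0 1) ^ 2} {a₀ a₁ : ℝ} {K : ℕ}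
  {UkH : (k : ℕ) → Hist (F.P K) k → GaugeField (F.P K) k (Matrix.specialUnitaryGroup (Fin 2) ℂ) →
    GaugeField (F.P K) 0 (Matrix.specialUnitaryGroup (Fin 2) ℂ)}

/-- **r1 GIVES PRINT'S PLAQUETTE CLAUSE FOR THE TRIVIAL-HISTORY MINIMISER ON THE WINDOW**: under the minimiser rows `MinimiserRowsT3 … a₀ a₁ K UkH`, for a height `n < K`
and a window datum `V` with `|V(∂p) − 1| < θ(n)`, `θ(n) ≤ a₁`, `B₃θ(n) ≤ a₀`, the minimiser `U_{K−n}(triv, V↑)` has `|U(∂p) − 1| < B₃θ(n)·L^{−2(K−n)}` for every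
plaquette of the finest lattice. [cite: Balaban1985Variational, Thm 1 (8) p.279, (2) p.278] -/
theorem plaqSmall_minimiser_of_rows (hmin : MinimiserRowsT3 F 𝔠 γ hγ hγ1 a₀ a₁ K UkH) {n : ℕ} (hnK : n < K)
    (hθa₁ : θBal F.L γ 𝔠.b₀ 𝔠.p₀ n ≤ a₁) (hθa₀ : 𝔠.B₃ * θBal F.L γ 𝔠.b₀ 𝔠.p₀ n ≤ a₀)
    (V : GaugeField (F.P n) 0 (Matrix.specialUnitaryGroup (Fin 2) ℂ)) (hV : PlaqSmall (θBal F.L γ 𝔠.b₀ 𝔠.p₀ n) V) :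
    PlaqSmall (regThreshold F n K (𝔠.B₃ * θBal F.L γ 𝔠.b₀ 𝔠.p₀ n))
      (UkH (K - n) (Hist.triv (F.P K) (K - n))
        (fieldShift (F.sitesPerDir_eq (m := F.m) (K := K) (j := K - n) (m' := F.m) (K' := n) (j' := 0) (by omega)) V)) := by
  have hγ1' : γ ≤ 1 := hγ1.trans (sq_min_one_le _ 𝔠.gamma0_pos)
  have hθ : 0 < θBal F.L γ 𝔠.b₀ 𝔠.p₀ n := T3MinimiserStabilityReduction.θBal_pos F.hL.2.le hγ hγ1' 𝔠.b₀_pos 𝔠.p₀ n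
  have h := (hmin.1 n hnK _ _ hθ hθa₁ le_rfl hθa₀ V hV).1
  exact ((mem_regFibrePr_iff F).mp h).2.plaqSmall

/-- **(44) FOR THE NATURAL OLD-LEVEL CONFIGURATION FAMILY AT THE (α) RECORD** — the analytic inequality of the (R4-low) display `CfgDistOwnΦLow` for the candidate
`B K (K−n) j Y W c := (1/i) log Ū^j(Γ_{y,c₋} ∪ c ∪ Γ_{c₊,y})`, `Ū^j` the `j`-fold `ℰp`-average of the r1 minimiser `U_{K−n}(triv, W)`, `y` an anchor: under the minimiser rows, on run
`K`'s `θ(n)`-window (`n < K`, `θ(n) ≤ a₁`, `B₃θ(n) ≤ a₀`, `B₃θ(n)` inside [B7] Prop. 2's letters), for every `j ≤ K − n`, anchor `y ∈ T^{(j)}` and bond `c` with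
`|c₋ − y|₁·2B₃θ(n)(L^{K−n−j})⁻² ≤ ½`: `‖B(c)‖ ≤ 4B₃·θ(n)·|c₋ − y|₁·(L^{K−n−1−j})⁻²` — print's «|B_k(c)| < (Lʲη)⁻¹|c₋ − y|·8L²B₃g_{k−1}p(g_{k−1})(Lʲη)²».
[cite: Balaban1985UV3, (44) p.267; Balaban1985Variational, Thm 1 (8) p.279; Balaban1985Averaging, Prop. 2 (54) p.26] -/
theorem norm_B27T_avg_minimiser_le (hmin : MinimiserRowsT3 F 𝔠 γ hγ hγ1 a₀ a₁ K UkH) {n : ℕ} (hnK : n < K)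
    (hθa₁ : θBal F.L γ 𝔠.b₀ 𝔠.p₀ n ≤ a₁) (hθa₀ : 𝔠.B₃ * θBal F.L γ 𝔠.b₀ 𝔠.p₀ n ≤ a₀)
    (he3 : (143 * ((((3 + 4 : ℕ) : ℝ)) ^ 2 / 4) ^ 2) * (𝔠.B₃ * θBal F.L γ 𝔠.b₀ 𝔠.p₀ n) ≤ 1 / 3)
    (he2 : 2 * (𝔠.B₃ * θBal F.L γ 𝔠.b₀ 𝔠.p₀ n) ≤ 2 * deltaSU (Fin 2) / (((3 + 4) * F.L : ℕ) : ℝ) ^ 2)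
    (V : GaugeField (F.P n) 0 (Matrix.specialUnitaryGroup (Fin 2) ℂ)) (hV : PlaqSmall (θBal F.L γ 𝔠.b₀ 𝔠.p₀ n) V)
    {j : ℕ} (hj : j ≤ K - n) (y : Site (F.P K) j) (c : PBond (F.P K) j)
    (hsmall : (l1 (rel y c.src) : ℝ) * (2 * (𝔠.B₃ * θBal F.L γ 𝔠.b₀ 𝔠.p₀ n) * (((F.L : ℝ) ^ (K - n - j))⁻¹) ^ 2) ≤ 1 / 2) :
    ‖B27T (unitsField (toUField (Averaging.iter (fun i => BlockAveraging.blockAvg (P := F.P K) (j := i) ℰp) j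
        (UkH (K - n) (Hist.triv (F.P K) (K - n))
          (fieldShift (F.sitesPerDir_eq (m := F.m) (K := K) (j := K - n) (m' := F.m) (K' := n) (j' := 0) (by omega)) V))))) y c‖ ≤
      4 * 𝔠.B₃ * θBal F.L γ 𝔠.b₀ 𝔠.p₀ n * (l1 (rel y c.src) : ℝ) * (((F.L : ℝ) ^ (K - n - 1 - j))⁻¹) ^ 2 := by
  have hγ1' : γ ≤ 1 := hγ1.trans (sq_min_one_le _ 𝔠.gamma0_pos)
  have hθ : 0 < θBal F.L γ 𝔠.b₀ 𝔠.p₀ n := T3MinimiserStabilityReduction.θBal_pos F.hL.2.le hγ hγ1' 𝔠.b₀_pos 𝔠.p₀ n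
  have h := norm_B27T_iter_blockAvg_le_T3_row F (mul_pos 𝔠.B₃_pos hθ) he3 he2 (plaqSmall_minimiser_of_rows hmin hnK hθa₁ hθa₀ V hV) hj y c hsmall
  calc _ ≤ _ := h
    _ = _ := by ring

end Record

/-! ## §4 Block geometry: the anchored ℓ¹ distance of (27)/(44) against the canonical leg distance of an old-term block -/

section Geometry

variable {F : T3Family}

/-- **THE DICTIONARY `|c₋ − y|₁ = pdist`**: the ℓ¹ length of the relative position (the letters of (27)/(28), `B7Prop1Explicit.l1 ∘ rel`) is the periodic ℓ¹ distance
(the letters of the canonical leg distance). [folklore] -/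
theorem cast_l1_rel_eq_pdist {K b : ℕ} (y x : Site (F.P K) b) : (l1 (rel y x) : ℝ) = pdist x y := by
  unfold l1 pdist
  push_cast
  refine Finset.sum_congr rfl fun ν _ => ?_
  rw [rel_apply, pabs_eq_natAbs, Int.cast_natCast, Nat.cast_natAbs, Int.cast_abs]

/-- Two residues with the same integer quotient by `L` of their labels are within `L − 1` of each other (periodically). [folklore] -/
theorem pabs_sub_le_of_div_eq {K b : ℕ} {u v : ZMod ((F.P K).sitesPerDir b)} (h : u.val / F.L = v.val / F.L) :
    pabs (u - v) ≤ (F.L : ℤ) - 1 := by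
  have hL : 0 < F.L := by have := F.hL.2; omega
  have hx : (((u.val : ℤ) - (v.val : ℤ) : ℤ) : ZMod ((F.P K).sitesPerDir b)) = u - v := by
    push_cast
    rw [ZMod.natCast_zmod_val, ZMod.natCast_zmod_val]
  refine (pabs_le_abs_of_cast_eq hx).trans ?_
  have hu := Nat.div_add_mod u.val F.L
  have hv := Nat.div_add_mod v.val F.L
  rw [h] at hu
  set q := v.val / F.L with hq
  set ru := u.val % F.L with hru
  set rv := v.val % F.L with hrv
  have hmu : ru < F.L := Nat.mod_lt _ hL
  have hmv : rv < F.L := Nat.mod_lt _ hL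
  have hu' : (F.L : ℤ) * (q : ℤ) + (ru : ℤ) = (u.val : ℤ) := by exact_mod_cast hu
  have hv' : (F.L : ℤ) * (q : ℤ) + (rv : ℤ) = (v.val : ℤ) := by exact_mod_cast hv
  have hmu' : (ru : ℤ) + 1 ≤ F.L := by exact_mod_cast hmu
  have hmv' : (rv : ℤ) + 1 ≤ F.L := by exact_mod_cast hmv
  have hmu0 : (0 : ℤ) ≤ (ru : ℤ) := by positivity
  have hmv0 : (0 : ℤ) ≤ (rv : ℤ) := by positivity
  rw [abs_le]
  constructor <;> linarith

/-- **THE IN-BLOCK SPREAD**: two level-`b` sites in the shadow of ONE level-`(b+1)` block are within periodic ℓ¹ distance `3(L − 1)` (standing range `b + 1 ≤ m + K`; the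
block level is a free letter `i = b + 1` so that `i := 1 + b`, the term level of `canonLocCore`, is served by `subst`). [cite: Balaban1987RG1, (0.3) p.252] -/
theorem pdist_le_of_mem_shadow_blockSet {K b i : ℕ} (hib : i = b + 1) (hb : i ≤ F.m + K) (y' : Site (F.P K) i) {z z' : Site (F.P K) b}
    (hz : z ∈ shadow K b (blockSet K i y')) (hz' : z' ∈ shadow K b (blockSet K i y')) :
    pdist z z' ≤ 3 * ((F.L : ℝ) - 1) := by
  subst hib
  obtain ⟨x, hx, rfl⟩ := mem_shadow.mp hz
  obtain ⟨x', hx', rfl⟩ := mem_shadow.mp hz'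
  have hxy : coarsen (b + 1) x = y' := hx
  have hxy' : coarsen (b + 1) x' = y' := hx'
  have hb' : b ≤ (F.P K).m + (F.P K).K := by show b ≤ F.m + K; omega
  have hb1 : b + 1 ≤ (F.P K).m + (F.P K).K := hb
  have hPL : (F.P K).L = F.L := rfl
  have hdiv : ∀ ν : Fin 3, ((coarsen b x) ν).val / F.L = ((coarsen b x') ν).val / F.L := by
    intro ν
    have h1 := val_coarsen (P := F.P K) (b + 1) hb1 x ν
    have h2 := val_coarsen (P := F.P K) (b + 1) hb1 x' ν
    rw [hxy, hPL] at h1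
    rw [hxy', hPL] at h2
    rw [val_coarsen (P := F.P K) b hb' x ν, val_coarsen (P := F.P K) b hb' x' ν, hPL, Nat.div_div_eq_div_mul, Nat.div_div_eq_div_mul,
      ← pow_succ]
    exact h1.symm.trans h2
  unfold pdist
  calc ∑ ν : Fin 3, (pabs ((coarsen b x) ν - (coarsen b x') ν) : ℝ) ≤ ∑ ν : Fin 3, ((F.L : ℝ) - 1) :=
        Finset.sum_le_sum fun ν _ => by exact_mod_cast pabs_sub_le_of_div_eq (hdiv ν)
    _ = 3 * ((F.L : ℝ) - 1) := by rw [Finset.sum_const, Finset.card_univ, Fintype.card_fin]; ring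

/-- **THE ANCHORED DISTANCE AGAINST THE CANONICAL LEG DISTANCE OF A BLOCK**: for an old-term block `Y = blockSet K i y′` (`i = b + 1 ≤ m + K`) and ANY anchor
`y ∈ anchors K b Y`, the ℓ¹ length of `c₋ − y` is at most `canonLegDist F K b Y c + 3(L − 1)` (the leg distance is attained at an anchor, and two anchors of a block are
`3(L−1)`-close; in the degenerate case the anchor set is the single origin). [cite: Balaban1985UV3, (43)-(44) pp.266-267] -/
theorem l1_rel_le_canonLegDist_add {K b i : ℕ} (hib : i = b + 1) (hb : i ≤ F.m + K) (y' : Site (F.P K) i) {y : Site (F.P K) b}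
    (hy : y ∈ anchors K b (blockSet K i y')) (c : PBond (F.P K) b) :
    (l1 (rel y c.src) : ℝ) ≤ canonLegDist F K b (blockSet K i y') c + 3 * ((F.L : ℝ) - 1) := by
  obtain ⟨z, hz, hzeq⟩ := exists_canonLegDist_eq (F := F) K b (blockSet K i y') c
  rw [cast_l1_rel_eq_pdist, hzeq]
  have hL1 : (1 : ℝ) ≤ F.L := by exact_mod_cast F.hL.2.le
  rcases anchors_eq_or (F := F) K b (blockSet K i y') with h | h
  · rw [h] at hy hz
    calc pdist c.src y ≤ pdist c.src z + pdist z y := pdist_triangle _ _ _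
      _ ≤ pdist c.src z + 3 * ((F.L : ℝ) - 1) := add_le_add le_rfl (pdist_le_of_mem_shadow_blockSet hib hb y' hz hy)
  · rw [h, Finset.mem_singleton] at hy hz
    rw [hy, hz]
    linarith

/-- The same in the (44) row's shape `C·(1 + d(c))`: `|c₋ − y|₁ ≤ 3L·(1 + canonLegDist F K b Y c)`. [cite: Balaban1985UV3, (44) p.267] -/
theorem l1_rel_le_mul_one_add_canonLegDist {K b i : ℕ} (hib : i = b + 1) (hb : i ≤ F.m + K) (y' : Site (F.P K) i) {y : Site (F.P K) b}
    (hy : y ∈ anchors K b (blockSet K i y')) (c : PBond (F.P K) b) :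
    (l1 (rel y c.src) : ℝ) ≤ 3 * (F.L : ℝ) * (1 + canonLegDist F K b (blockSet K i y') c) := by
  have h := l1_rel_le_canonLegDist_add hib hb y' hy c
  have hL1 : (1 : ℝ) ≤ F.L := by exact_mod_cast F.hL.2.le
  have hd : 0 ≤ canonLegDist F K b (blockSet K i y') c := canonLegDist_nonneg F K b _ c
  nlinarith

end Geometry

/-! ## §5 (44) for the natural old-level configuration family IN THE ROW'S CURRENCY: `‖B(c)‖ ≤ C_s·(1 + canonLegDist K j Y c)·θ(n)·(L^{K−n−1−j})⁻²`, `C_s = 12·L·B₃` -/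

section Row

variable {F : T3Family} {𝔠 : AlphaConsts F.L (suGroupModel 2).N} {γ : ℝ} {hγ : 0 < γ} {hγ1 : γ ≤ (min 𝔠.gamma0 1) ^ 2} {a₀ a₁ : ℝ} {K : ℕ}
  {UkH : (k : ℕ) → Hist (F.P K) k → GaugeField (F.P K) k (Matrix.specialUnitaryGroup (Fin 2) ℂ) →
    GaugeField (F.P K) 0 (Matrix.specialUnitaryGroup (Fin 2) ℂ)}

/-- **(44) FOR THE NATURAL OLD-LEVEL CONFIGURATION FAMILY, IN THE CURRENCY OF `CfgDistOwnΦLow`**: under the minimiser rows r1–r3, on run `K`'s `θ(n)`-window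
(`θ(n) ≤ a₁`, `B₃θ(n) ≤ a₀`, `B₃θ(n)` inside [B7] Prop. 2's letters), for every OLD level `j + 1 < K − n` (so `i := j + 1` is the term level of an old block
`Y = blockSet K i y′` of `canonLocCore`), every anchor `y ∈ anchors K j Y` and every bond `c` of `T^{(j)}` in print's regime `|c₋ − y|₁·2B₃θ(n)(L^{K−n−j})⁻² ≤ ½`:
the (27)-loop variable of the `j`-fold `ℰp`-average of the r1 minimiser `U_{K−n}(triv, V↑)` anchored at `y` satisfies
`‖B(c)‖ ≤ (12·L·B₃)·(1 + canonLegDist F K j Y c)·θ(n)·(L^{K−n−1−j})⁻²` — the RIGHT-HAND SIDE OF THE ROW `CfgDistOwnΦLow … (canonLegDist F) 𝔠.b₀ 𝔠.p₀ (12·L·B₃)`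
verbatim.  (What is NOT here: the definition of the family `B` of the display — a `def`, the (α)-record desk's — and the far legs `|c₋ − y|₁·α > ½`, where print's (44)
is not used (localisation of `𝒫_j(Y_j)`, p.263 L4) and the row as typed still asks a bound.) [cite: Balaban1985UV3, (44) p.267, (27)-(28) p.263; Balaban1985Variational, Thm 1 (8) p.279; Balaban1985Averaging, Prop. 2 (54) p.26] -/
theorem norm_B27T_avg_minimiser_le_canonLegDist (hmin : MinimiserRowsT3 F 𝔠 γ hγ hγ1 a₀ a₁ K UkH) {n : ℕ} (hnK : n < K)
    (hθa₁ : θBal F.L γ 𝔠.b₀ 𝔠.p₀ n ≤ a₁) (hθa₀ : 𝔠.B₃ * θBal F.L γ 𝔠.b₀ 𝔠.p₀ n ≤ a₀)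
    (he3 : (143 * ((((3 + 4 : ℕ) : ℝ)) ^ 2 / 4) ^ 2) * (𝔠.B₃ * θBal F.L γ 𝔠.b₀ 𝔠.p₀ n) ≤ 1 / 3)
    (he2 : 2 * (𝔠.B₃ * θBal F.L γ 𝔠.b₀ 𝔠.p₀ n) ≤ 2 * deltaSU (Fin 2) / (((3 + 4) * F.L : ℕ) : ℝ) ^ 2)
    (V : GaugeField (F.P n) 0 (Matrix.specialUnitaryGroup (Fin 2) ℂ)) (hV : PlaqSmall (θBal F.L γ 𝔠.b₀ 𝔠.p₀ n) V)
    {j i : ℕ} (hij : i = j + 1) (hi : i < K - n) (y' : Site (F.P K) i) {y : Site (F.P K) j} (hy : y ∈ anchors K j (blockSet K i y'))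
    (c : PBond (F.P K) j)
    (hsmall : (l1 (rel y c.src) : ℝ) * (2 * (𝔠.B₃ * θBal F.L γ 𝔠.b₀ 𝔠.p₀ n) * (((F.L : ℝ) ^ (K - n - j))⁻¹) ^ 2) ≤ 1 / 2) :
    ‖B27T (unitsField (toUField (Averaging.iter (fun i => BlockAveraging.blockAvg (P := F.P K) (j := i) ℰp) j
        (UkH (K - n) (Hist.triv (F.P K) (K - n))
          (fieldShift (F.sitesPerDir_eq (m := F.m) (K := K) (j := K - n) (m' := F.m) (K' := n) (j' := 0) (by omega)) V))))) y c‖ ≤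
      (12 * (F.L : ℝ) * 𝔠.B₃) * (1 + canonLegDist F K j (blockSet K i y') c) * θBal F.L γ 𝔠.b₀ 𝔠.p₀ n * (((F.L : ℝ) ^ (K - n - 1 - j))⁻¹) ^ 2 := by
  have hγ1' : γ ≤ 1 := hγ1.trans (sq_min_one_le _ 𝔠.gamma0_pos)
  have hθ : 0 < θBal F.L γ 𝔠.b₀ 𝔠.p₀ n := T3MinimiserStabilityReduction.θBal_pos F.hL.2.le hγ hγ1' 𝔠.b₀_pos 𝔠.p₀ n
  have hB : 0 < 𝔠.B₃ := 𝔠.B₃_pos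
  have h1 := norm_B27T_avg_minimiser_le hmin hnK hθa₁ hθa₀ he3 he2 V hV (show j ≤ K - n by omega) y c hsmall
  have h2 := l1_rel_le_mul_one_add_canonLegDist hij (show i ≤ F.m + K by omega) y' hy c
  have hx : 0 ≤ (((F.L : ℝ) ^ (K - n - 1 - j))⁻¹) ^ 2 := by positivity
  have h3 : 4 * 𝔠.B₃ * θBal F.L γ 𝔠.b₀ 𝔠.p₀ n * (l1 (rel y c.src) : ℝ) ≤
      4 * 𝔠.B₃ * θBal F.L γ 𝔠.b₀ 𝔠.p₀ n * (3 * (F.L : ℝ) * (1 + canonLegDist F K j (blockSet K i y') c)) :=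
    mul_le_mul_of_nonneg_left h2 (by positivity)
  calc _ ≤ 4 * 𝔠.B₃ * θBal F.L γ 𝔠.b₀ 𝔠.p₀ n * (l1 (rel y c.src) : ℝ) * (((F.L : ℝ) ^ (K - n - 1 - j))⁻¹) ^ 2 := h1
    _ ≤ 4 * 𝔠.B₃ * θBal F.L γ 𝔠.b₀ 𝔠.p₀ n * (3 * (F.L : ℝ) * (1 + canonLegDist F K j (blockSet K i y') c)) * (((F.L : ℝ) ^ (K - n - 1 - j))⁻¹) ^ 2 :=
        mul_le_mul_of_nonneg_right h3 hx
    _ = _ := by ring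

end Row


end Summit.QuantumFields.YangMills.Theorems.GlobalSlackKernelLeg

end
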